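import Summits.CriticalPhenomena.PercolationContinuityZ3.Theorems.PercNearOneGluingNoHeavyLowerTailMajorityGluingQCertSym3CountBridge
import Summits.CriticalPhenomena.PercolationContinuityZ3.Theorems.PercNearOneGluingNoHeavyLowerTailMajorityGluingQCertSym3Count
import HarnessLib

/-!
# THE TYPE-SPACE CHECKER for symmetrised degree-3 certificates (lane prim-rate, constants-miner 1, gen 37; census/g37/TYPE-SPACE-CHECKER.md step 3f)

Support file for the closed crux `NoHeavyLowerTail` (stmt-CriticalPhenomena-4575), majority-gluing line.  `SymCert3.contribs3Y`: the contributions of a certificate computed in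
TYPE SPACE — for each multiplier term / marginal slack / row×lift the relay-by-relay table of Venn count codes (`tabM`, `tabF` of `…QCertSym3CountVec/Bridge`) mapped through
`keyOfCode` (`…QCertSym3CountKey`) — instead of one key per enumerated monomial (squares stay enumerated in this version).  **`evalC_contribs3Y`**: under the structural check
`checkW3S`, `evalC val c.contribs3Y = evalC val c.contribs3S` for every valuation; hence **`cut_of_checkY_count`**: `checkW3S` and `checkQ3Y fuel = runsOK (msort2 fuel contribs3Y)`
give the counting form `cD·μ(h ≤ #cut) ≤ cN·δ` exactly like `cut_of_checkS3_count`.  Kernel cost O(#count vectors) per entry instead of O(cylinder sizes).  No sorries.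
-/

noncomputable section

namespace Summit.CriticalPhenomena.PercolationContinuityZ3.Theorems

open MeasureTheory Set
open Literature.Probability.LatticeModels (prodBernoulli)
open Literature.Probability.Percolation
open scoped Classical

namespace HubOnly
namespace QCert

/-! ### Generic evaluation lemmas -/

/-- Evaluating a key-mapped, scaled table. -/
theorem evalC_map_key (val : ℕ → ℝ) (f : ℕ → ℕ) (z : ℤ) (tab : List (ℕ × ℤ)) :
    evalC val (tab.map fun e => (f e.1, z * e.2)) = (z : ℝ) * evalC (fun code => val (f code)) tab := by
  induction tab with
  | nil => simp [evalC]
  | cons e l ih =>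
    simp only [evalC, List.map_cons, List.sum_cons, List.map_map] at ih ⊢
    rw [ih]; push_cast; ring

/-- Evaluating at an indicator-restricted function = evaluating the filtered table. -/
theorem evalC_filter (g : ℕ → ℝ) (P : ℕ → Bool) (tab : List (ℕ × ℤ)) :
    evalC (fun code => if P code then g code else 0) tab = evalC g (tab.filter fun e => P e.1) := by
  induction tab with
  | nil => simp [evalC]
  | cons e l ih =>
    have ih' := ih
    unfold evalC at ih' ⊢
    simp only [mul_ite, mul_zero] at ih' ⊢
    rw [List.filter_cons]
    cases hP : P e.1 <;> simp [hP, ih']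

/-- A constant-coefficient list over a support. -/
theorem evalC_map_const (val : ℕ → ℝ) (L : List ℕ) (f : ℕ → ℕ) (z : ℤ) :
    evalC val (L.map fun j => (f j, z)) = (z : ℝ) * (L.map fun j => val (f j)).sum := by
  induction L with
  | nil => simp [evalC]
  | cons a l ih =>
    simp only [evalC, List.map_cons, List.sum_cons, List.map_map] at ih ⊢
    rw [ih]; ring

namespace SymCert3

variable {n k : ℕ}
variable (c : SymCert3)

/-! ### The type-space contribution list -/

/-- Depth fuel for the table merges. -/
def fuelY : ℕ := 64

/-- The base of the count codes (`> m`). -/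
def Bs : ℕ := c.base.m + 1

/-- Popcount of the first slot read off a count code. -/
def popcDigits (Bs code : ℕ) : ℕ := digit Bs code 4 + digit Bs code 5 + digit Bs code 6 + digit Bs code 7

/-- A table mapped through the key-of-code (fixed D-flags) with coefficients scaled by `z`. -/
def keyTab (di dj dk : Bool) (z : ℤ) (tab : List (ℕ × ℤ)) : List (ℕ × ℤ) :=
  tab.map fun e => (keyOfCode c.base.m c.Bs di dj dk e.1, z * e.2)

/-- Type-space contributions of `z·f(A,X)·f(B,Y)·x_t`. -/
def prodY (A X B Y t : ℕ) (z : ℤ) : List (ℕ × ℤ) := c.keyTab false false (t == c.base.D) z (tabM c.Bs A X B Y t fuelY c.base.m)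

/-- Type-space contributions of a row times `x_t`. -/
def rowY (r : RowE3) : List (ℕ × ℤ) :=
  c.prodY (r.row.A ||| r.row.B) (r.row.X &&& r.row.Y) 0 (r.row.X ||| r.row.Y) r.t (-(r.row.n : ℤ)) ++ c.prodY r.row.A r.row.X r.row.B r.row.Y r.t (r.row.n : ℤ)

/-- Type-space contributions of a marginal slack `n·(x_D − m_x)·x_a x_b` (negated). -/
def linY (e : ℕ × ℕ × ℕ × ℕ) : List (ℕ × ℤ) :=
  (keyOfCode c.base.m c.Bs true (e.2.1 == c.base.D) (e.2.2.1 == c.base.D) (cvcode c.Bs c.base.m c.base.D e.2.1 e.2.2.1), -(e.2.2.2 : ℤ)) ::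
    c.keyTab false (e.2.1 == c.base.D) (e.2.2.1 == c.base.D) (e.2.2.2 : ℤ) (tabF c.Bs 0 (2 ^ e.1) e.2.1 e.2.2.1 fuelY c.base.m)

/-- Type-space contributions of a multiplier term `n·(cN x_D − cD T)·x_a x_b`. -/
def ell2Y (e : ℕ × ℕ × ℕ) : List (ℕ × ℤ) :=
  (keyOfCode c.base.m c.Bs true (e.1 == c.base.D) (e.2.1 == c.base.D) (cvcode c.Bs c.base.m c.base.D e.1 e.2.1), (e.2.2 : ℤ) * c.base.cN) ::
    c.keyTab false (e.1 == c.base.D) (e.2.1 == c.base.D) (-((e.2.2 : ℤ) * c.base.cD))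
      ((tabF c.Bs 0 0 e.1 e.2.1 fuelY c.base.m).filter fun t => decide (c.base.h ≤ popcDigits c.Bs t.1))

/-- **All contributions, computed in type space** (squares enumerated as in `contribs3S`). -/
def contribs3Y : List (ℕ × ℤ) :=
  (c.ell2.map c.ell2Y).flatten ++ (c.lin.map c.linY).flatten ++
    (c.rows.map fun ch => (ch.map c.rowY).flatten).flatten ++ (c.sqs.map fun ch => (ch.map c.sqC3S).flatten).flatten

/-- **The type-space key check.** -/
def checkQ3Y (fuel : ℕ) : Bool := runsOK (msort2 fuel c.contribs3Y)

/-! ### Soundness: the type-space list evaluates like the enumerated one -/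

/-- Keys of patterns/δ below `2^m + 1` are keys of codes. -/
theorem val_key_eq (val : ℕ → ℝ) (i j t : ℕ) (hi : i < 2 ^ c.base.m + 1) (hj : j < 2 ^ c.base.m + 1) (ht : t < 2 ^ c.base.m + 1) :
    val (c.key i j t) = val (keyOfCode c.base.m c.Bs (i == c.base.D) (j == c.base.D) (t == c.base.D) (cvcode c.Bs c.base.m i j t)) := by
  rw [show c.key i j t = keyS3 c.base.m i j t from rfl, ← keyT_eq, keyT_eq_keyOfCode c.base.m c.Bs i j t (Nat.lt_succ_self _) hi hj ht]
  rfl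

/-- Patterns are not `δ`. -/
theorem beq_D_false {m i : ℕ} (hi : i < 2 ^ m) : (i == 2 ^ m) = false := by
  simp [Nat.ne_of_lt hi]

/-- Evaluation of an enumerated cylinder-pair product. -/
theorem evalC_prodC3S_lists (val : ℕ → ℝ) (m1 m2 t : ℕ) (z : ℤ) :
    evalC val (c.prodC3S m1 m2 t z) = (z : ℝ) * ((suppOf c.NV (tb m1)).map fun i => ((suppOf c.NV (tb m2)).map fun j => val (c.key i j t)).sum).sum := by
  unfold prodC3S
  rw [evalC_flatten, List.map_map, ← List.sum_map_mul_left]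
  congr 1
  refine List.map_congr_left fun i _ => ?_
  simp only [Function.comp]
  exact evalC_map_const val _ _ z

/-- **Soundness of `prodY`**: for validated cylinder masks, the enumerated product evaluates like its type-space table. -/
theorem evalC_prodY (val : ℕ → ℝ) (A X B Y m1 m2 t : ℕ) (z : ℤ) (hX : X < 2 ^ c.base.m) (hY : Y < 2 ^ c.base.m)
    (h1 : c.base.maskOK A X m1 = true) (h2 : c.base.maskOK B Y m2 = true) (ht : t < c.NV) :
    evalC val (c.prodC3S m1 m2 t z) = evalC val (c.prodY A X B Y t z) := by
  obtain ⟨h1a, h1b⟩ := maskOK_spec c.base A X m1 h1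
  obtain ⟨h2a, h2b⟩ := maskOK_spec c.base B Y m2 h2
  have hNV : c.NV = 2 ^ c.base.m + 1 := rfl
  rw [evalC_prodC3S_lists, hNV, suppOf_mask_eq_cylR c.base.m A X m1 h1a hX h1b, suppOf_mask_eq_cylR c.base.m B Y m2 h2a hY h2b]
  unfold prodY keyTab
  rw [evalC_map_key, ← cylSum_eq_evalC_tabM]
  unfold cylSum
  congr 1
  refine congrArg List.sum (List.map_congr_left fun i hi => congrArg List.sum (List.map_congr_left fun j hj => ?_))
  have hi' := lt_of_mem_cylR hi
  have hj' := lt_of_mem_cylR hj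
  rw [c.val_key_eq val i j t (by omega) (by omega) (hNV ▸ ht), show c.base.D = 2 ^ c.base.m from rfl, beq_D_false hi', beq_D_false hj']

/-- `rowOK` unpacked. -/
theorem rowOK_spec (r : RowE) (h : c.base.rowOK r = true) :
    r.A < 2 ^ c.base.m ∧ r.X < 2 ^ c.base.m ∧ r.B < 2 ^ c.base.m ∧ r.Y < 2 ^ c.base.m ∧
      c.base.maskOK r.A r.X r.m1 = true ∧ c.base.maskOK r.B r.Y r.m2 = true ∧
      c.base.maskOK (r.A ||| r.B) (r.X &&& r.Y) r.m3 = true ∧ c.base.maskOK 0 (r.X ||| r.Y) r.m4 = true := by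
  unfold Cert.rowOK at h
  simp only [Bool.and_eq_true, decide_eq_true_eq] at h
  tauto

/-- **Soundness of `rowY`.** -/
theorem evalC_rowY (val : ℕ → ℝ) (r : RowE3) (h : c.base.rowOK r.row = true) (ht : r.t < c.NV) : evalC val (c.rowC3S r) = evalC val (c.rowY r) := by
  obtain ⟨_, hX, _, hY, h1, h2, h3, h4⟩ := c.rowOK_spec r.row h
  unfold rowC3S rowY
  rw [evalC_append, evalC_append, c.evalC_prodY val _ _ _ _ _ _ _ _ (Nat.and_lt_two_pow _ hY) (Nat.or_lt_two_pow hX hY) h3 h4 ht,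
    c.evalC_prodY val _ _ _ _ _ _ _ _ hX hY h1 h2 ht]

/-- **Soundness of `linY`.** -/
theorem evalC_linY (val : ℕ → ℝ) (e : ℕ × ℕ × ℕ × ℕ) (hx : e.1 < c.base.m) (ha : e.2.1 < c.NV) (hb : e.2.2.1 < c.NV) :
    evalC val (c.linC3 e) = evalC val (c.linY e) := by
  have hNV : c.NV = 2 ^ c.base.m + 1 := rfl
  have hD : c.base.D < 2 ^ c.base.m + 1 := Nat.lt_succ_self _
  unfold linC3 linY
  unfold evalC
  rw [List.map_cons, List.sum_cons, List.map_cons, List.sum_cons]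
  congr 1
  · rw [c.val_key_eq val _ _ _ hD (hNV ▸ ha) (hNV ▸ hb)]; simp
  · change evalC val _ = evalC val (c.keyTab _ _ _ _ _)
    unfold keyTab
    rw [evalC_map_key, ← fixSum_eq_evalC_tabF, evalC_map_const, show c.base.margMem e.1 = fun K => decide (K < 2 ^ c.base.m) && tb K e.1 from rfl, hNV,
      suppOf_marg_eq_cylR c.base.m e.1 hx]
    unfold fixSum
    congr 1
    refine congrArg List.sum (List.map_congr_left fun i hi => ?_)
    have hi' := lt_of_mem_cylR hi
    rw [c.val_key_eq val i _ _ (by omega) (hNV ▸ ha) (hNV ▸ hb), show c.base.D = 2 ^ c.base.m from rfl, beq_D_false hi']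

/-- The popcount of the first slot is read off the code. -/
theorem popc_eq_popcDigits (i a b : ℕ) : popc c.base.m i = popcDigits c.Bs (cvcode c.Bs c.base.m i a b) := by
  have hB : c.base.m < c.Bs := Nat.lt_succ_self _
  unfold popcDigits
  rw [digit_cvcode _ _ _ _ _ _ hB (by norm_num), digit_cvcode _ _ _ _ _ _ hB (by norm_num), digit_cvcode _ _ _ _ _ _ hB (by norm_num),
    digit_cvcode _ _ _ _ _ _ hB (by norm_num)]
  exact popc_eq_ccnt_i c.base.m i a b

/-- **Soundness of `ell2Y`.** -/
theorem evalC_ell2Y (val : ℕ → ℝ) (e : ℕ × ℕ × ℕ) (ha : e.1 < c.NV) (hb : e.2.1 < c.NV) : evalC val (c.ell2C e) = evalC val (c.ell2Y e) := by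
  have hNV : c.NV = 2 ^ c.base.m + 1 := rfl
  have hD : c.base.D < 2 ^ c.base.m + 1 := Nat.lt_succ_self _
  unfold ell2C ell2Y
  unfold evalC
  rw [List.map_cons, List.sum_cons, List.map_cons, List.sum_cons]
  congr 1
  · rw [c.val_key_eq val _ _ _ hD (hNV ▸ ha) (hNV ▸ hb)]; simp
  · change evalC val _ = evalC val (c.keyTab _ _ _ _ _)
    unfold keyTab
    rw [evalC_map_key, ← evalC_filter _ (fun code => decide (c.base.h ≤ popcDigits c.Bs code)), ← fixSum_eq_evalC_tabF, evalC_map_const,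
      show c.base.tMem = fun K => decide (K < 2 ^ c.base.m) && decide (c.base.h ≤ popc c.base.m K) from rfl, hNV, suppOf_tMem_eq, sum_map_filter]
    unfold fixSum
    congr 1
    refine congrArg List.sum (List.map_congr_left fun i hi => ?_)
    have hi' : i < 2 ^ c.base.m := by have := lt_of_mem_cylR hi; exact this
    beta_reduce
    rw [← c.popc_eq_popcDigits i e.1 e.2.1]
    by_cases hh : c.base.h ≤ popc c.base.m i
    · rw [if_pos (decide_eq_true hh), if_pos (decide_eq_true hh),
        c.val_key_eq val i _ _ (by omega) (hNV ▸ ha) (hNV ▸ hb), show c.base.D = 2 ^ c.base.m from rfl, beq_D_false hi']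
    · rw [if_neg (by simp [hh]), if_neg (by simp [hh])]

/-- `checkW3S` unpacked: the four entry-wise facts. -/
theorem checkW3S_entries (h : c.checkW3S = true) :
    (∀ e ∈ c.ell2, e.1 < c.NV ∧ e.2.1 < c.NV) ∧ (∀ e ∈ c.lin, e.1 < c.base.m ∧ e.2.1 < c.NV ∧ e.2.2.1 < c.NV) ∧
      (∀ ch ∈ c.rows, ∀ r ∈ ch, c.base.rowOK r.row = true ∧ r.t < c.NV) := by
  unfold checkW3S at h
  simp only [Bool.and_eq_true, List.all_eq_true, decide_eq_true_eq] at h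
  obtain ⟨⟨⟨⟨_, he⟩, hl⟩, hr⟩, _⟩ := h
  exact ⟨fun e he' => he e he', fun e he' => ⟨(hl e he').1.1, (hl e he').1.2, (hl e he').2⟩, fun ch hch r hr' => hr ch hch r hr'⟩

/-- Flattened maps with termwise equal evaluations. -/
theorem evalC_flatten_congr {α : Type} (val : ℕ → ℝ) (l : List α) (f g : α → List (ℕ × ℤ)) (h : ∀ a ∈ l, evalC val (f a) = evalC val (g a)) :
    evalC val (l.map f).flatten = evalC val (l.map g).flatten := by
  rw [evalC_flatten, evalC_flatten, List.map_map, List.map_map]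
  exact congrArg List.sum (List.map_congr_left fun a ha => h a ha)

/-- **SOUNDNESS OF THE TYPE-SPACE LIST**: it evaluates like the enumerated contribution list. -/
theorem evalC_contribs3Y (hW : c.checkW3S = true) (val : ℕ → ℝ) : evalC val c.contribs3Y = evalC val c.contribs3S := by
  obtain ⟨he, hl, hr⟩ := c.checkW3S_entries hW
  unfold contribs3Y contribs3S
  rw [evalC_append, evalC_append, evalC_append, evalC_append, evalC_append, evalC_append]
  have e1 : evalC val (c.ell2.map c.ell2Y).flatten = evalC val (c.ell2.map c.ell2C).flatten :=
    evalC_flatten_congr val _ _ _ fun e hm => (c.evalC_ell2Y val e (he e hm).1 (he e hm).2).symm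
  have e2 : evalC val (c.lin.map c.linY).flatten = evalC val (c.lin.map c.linC3).flatten :=
    evalC_flatten_congr val _ _ _ fun e hm => (c.evalC_linY val e (hl e hm).1 (hl e hm).2.1 (hl e hm).2.2).symm
  have e3 : evalC val (c.rows.map fun ch => (ch.map c.rowY).flatten).flatten = evalC val (c.rows.map fun ch => (ch.map c.rowC3S).flatten).flatten :=
    evalC_flatten_congr val _ _ _ fun ch hch => evalC_flatten_congr val _ _ _ fun r hr' => (c.evalC_rowY val r (hr ch hch r hr').1 (hr ch hch r hr').2).symm
  rw [e1, e2, e3]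

/-- **THE FULL TYPE-SPACE CHECK** (structure + keys). -/
def check3Y (fuel : ℕ) : Bool := c.checkW3S && c.checkQ3Y fuel

/-- **«AT LEAST `h` OF `k` RELAYS CUT» FROM A TYPE-SPACE-CHECKED CERTIFICATE** (counting form, as `cut_of_checkS3_count`). [cite: VandenbergKahn2001, Thm 1.2 (p. 123)] -/
theorem cut_of_checkY_count (hm : c.base.m = k) (fuel : ℕ) (hc : c.check3Y fuel = true)
    (w : Sym2 (Fin n) → unitInterval) (a₀ : Fin n) (T : Finset (Fin n))
    (hT : T.card = k) (δ : ℝ) (hδ0 : 0 ≤ δ) (hδ : ∀ v ∈ T, (prodBernoulli w).real (openConn v a₀ : Set (BondConfig (Fin n)))ᶜ ≤ δ) :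
    (c.base.cD : ℝ) * (prodBernoulli w).real {ω : BondConfig (Fin n) | c.base.h ≤ (T.filter fun v => ω ∉ openConn v a₀).card} ≤
      c.base.cN * δ := by
  unfold check3Y at hc
  rw [Bool.and_eq_true] at hc
  have hpos : ∀ val : ℕ → ℝ, (∀ key, 0 ≤ val key) → 0 ≤ evalC val c.contribs3S := fun val hval => by
    rw [← c.evalC_contribs3Y hc.1 val]
    exact evalC_nonneg_of_runsOK_msort2 val hval fuel _ hc.2
  exact cut_of_posS3_count c hm hc.1 hpos w a₀ T hT δ hδ0 hδ

/-- Smoke test (kernel): the `(2,1)` smoke certificate of `…QCertSym3` passes the type-space check. -/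
theorem sym3Smoke_checkY : sym3Smoke.check3Y 8 = true := by decide +kernel

end SymCert3

end QCert
end HubOnly

end Summit.CriticalPhenomena.PercolationContinuityZ3.Theorems

end
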